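import Summits.QuantumFields.YangMills.Theorems.FluctuationComparisonRegPrIntLS2BetaSqrtGaugeStageIBlock
import Summits.QuantumFields.YangMills.Theorems.FluctuationComparisonRegPrIntLS2BetaSlowTwoFaceConeCentre
import Summits.QuantumFields.YangMills.Theorems.FluctuationComparisonRegPrIntLS2BetaSqrtGaugeFillingTubeSection
import HarnessLib

/-!
# S2β · D-GUARD ∕ (BG∞) — THE TWO-FACE SECTION OF A BOX-BLOCK ((F1a), part 1∕2 of FILL₁: the SITE-LEVEL Stage-I section discharging the filling letter `h₁` of
# ✓`…SectionsOfFillings.hSec_of_fillings` in the slow case): in dimension `3`, on a box of sides `n` (per axis) at corner `s`, a datum `ψ : Site → SU2` whose bonds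
# with both ends on an `α`-face are `ε`-slow admits a section `W : Site → SU2` equal to `ψ` on the two `α`-faces and `B`-slow on every bond of the box, for any `B`
# dominating `max (π∕ℓ₁) (π∕ℓ₂)` (`ℓ₁ + ℓ₂ = n α`) and `((π−r)∕sin r)·ε` — centre from ✓`…SlowTwoFaceConeCentre` (LEAD w3 g29, (B3-I)), two-leg filling from
# ✓`…SqrtGaugeStageIBlock` (px19 g25, (L-I)), sites ↔ offsets by ✓`…BlockOffsetCoordinates` and ✓`…SqrtGaugeFillingTubeSection` §1–§3 (px5 g24)

Cell `ym3-torus` (YM ladder rung R3 = continuum `SU(2)` Yang–Mills on the three-torus at fixed lattice data — a RUNG: NOT d = 4, NOT infinite volume,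
NOT a mass gap, NOT Clay).  Width seat «width 20» `ym3-torus-px20` (gen 25), FREE px helper on crux `stmt-QuantumFields-20520` (`FluctuationComparisonRegPrIntL`;
registry `Lines/semiclassical_s2beta.lean` v11 3732b7df UNTOUCHED, 0∕5), free hand on FILL₁ per LEAD-20520 w3 g29 №64 and `Cruxes/…/FILL1-SPEC-w3g29.md` (road (i));
`--kind proof --supports stmt-QuantumFields-20520 --as helper`, count-neutral, DEFINITION-FREE (0 `def`, 0 `instance`, 0 `notation`, 0 `sorry`, default heartbeats).
Currency of `hSec_of_fillings`' letter `h₁` (box `∀ κ, (x κ − (s κ : ZMod N)).val ≤ n κ`, faces `t_α ∈ {0, n α}`), at a general level `j`.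

WHY.  `hBG ⟸ FILL₁` by kernel (✓`…FlooredSupplierOfFillings.hBG_of_fillings`, LEAD p840681, with `h₂ = fill_tube`, `h₃ = fill3` inside); FILL₁ = «Stage I on a
box-block, at the site level, at the single scale `E = 1∕40`».  This file is the geometric core with the numerics as displayed hypotheses (`r`, `m`, `hrad`, `hcard`,
`ℓ₁ ℓ₂`, `hB1`, `hB2`); part 2∕2 (`…SqrtGaugeFill1`) fixes the numbers and serves the non-slow case by `W := ψ`.

WHAT IS PROVED (sorry-free).  ★★★ `twoFace_section (hd : P.d = 3) (n s) (hN : ∀ κ, n κ + 1 < N) (α) (ℓ₁ ℓ₂) (hℓ₁ : 0 < ℓ₁) (hℓ₂ : 0 < ℓ₂) (hℓ : ℓ₁ + ℓ₂ = n α) (ψ)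
(hε : 0 ≤ ε) (hr : 0 < r) (hrπ : 3r∕2 ≤ π) (m) (hm) (hrad) (hcard : two-face count for every pair of sides) (hB1 : max (π∕ℓ₁) (π∕ℓ₂) ≤ B) (hB2 : ((π−r)∕sin r)·ε ≤ B)
(hletters : the bonds of ψ with both ends on an α-face of the box are ε-slow) : ∃ W : Site P j → SU2, (W = ψ on the two α-faces of the box) ∧ (every bond of the box has
dist1 (W src·(W tgt)⁻¹) ≤ B)`.  Construction: `W t := fill(φ₀, φ₁, a, ℓ₁, ℓ₂; t_α)` of ✓(L-I) with the GUARDED face data `φ₀ u := ψ(site of u|_{α↦0})`,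
`φ₁ u := ψ(site of u|_{α↦n α})` for `u` in the box and the corner data outside (so the «no cut locus» letters hold for every `u`), centre `a` from
✓`exists_twoFaceCentre` (PACKING of the two slow faces; no connection between them is needed); faces by ✓`stageI_face_zero` ∕ ✓`stageI_face_end`, axial bonds by
✓`dist1_stageI_axial_le`, transverse bonds by ✓`dist1_stageI_transverse_le` + the face letters at the two face-adjacent bonds.

HONEST SCOPE.  Composition + site∕offset bookkeeping over landed bricks; no gauge field; nothing of Bałaban's renormalisation-group analysis is asserted or proved
([Balaban1985RegularSpaces] Lemma 1 p.79, Thm 2 p.83 — local small gauges).  FILL₁ (part 2), `hBG`, the floored `hsupp`, (BG∞) are NOT proved here; GAP♯∘ (registry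
UNTOUCHED), the five registered stubs (0∕5), S2β, 20520, 19936, 19200, `YM3TorusSU2` are NOT proved; no registered stub is closed; rung R3 — NOT d = 4, NOT infinite
volume, NOT a mass gap, NOT Clay; the Yang–Mills mass gap is NOT proved.  Axioms standard.

References: T. Bałaban, CMP **99** (1985) 75–102 [Balaban1985RegularSpaces] (Lemma 1 p.79, Thm 2 p.83).
-/

set_option autoImplicit false

noncomputable section

namespace Summit.QuantumFields.YangMills.Theorems.FluctuationComparisonRegPrIntLS2BetaSqrtGaugeFillingTwoFaceSection

open scoped Real
open Literature.MathematicalPhysics.QuantumLattice (su2Quat)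
open Literature.MathematicalPhysics.QuantumFieldTheory.Balaban1983to89
open T4CubeChartGnomonic (SU2)
open T4HaarSU2ExpChart (expPoint)
open T4ExpWindowSmallField (logVec)
open Summit.QuantumFields.YangMills.Theorems.FluctuationComparisonRegPrIntLS2BetaBlockOffsetCoordinates (read_tgt_eq offsets_tgt_eq_update)
open Summit.QuantumFields.YangMills.Theorems.FluctuationComparisonRegPrIntLS2BetaSqrtGaugeFillingTubeSection
  (exists_third_axis eq_update3 offset_siteOf siteOf_offset tgt_siteOf upd3_apply_fst upd3_apply_snd upd3_apply_thd)
open Summit.QuantumFields.YangMills.Theorems.FluctuationComparisonRegPrIntLS2BetaSqrtGaugeStageIBlock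
  (stageI_face_zero stageI_face_end dist1_stageI_axial_le dist1_stageI_transverse_le update_offsetZero_of_eq_zero)
open Summit.QuantumFields.YangMills.Theorems.FluctuationComparisonRegPrIntLS2BetaSlowTwoFaceConeCentre (exists_twoFaceCentre)

variable {P : Params} {j : ℕ}

/-! ## The two-face section (slow case) -/

/-- ★★★ **THE TWO-FACE SECTION OF A BOX-BLOCK (slow data)**: in dimension `3`, on the box of sides `n` at corner `s` with `n κ + 1 < N`, split `ℓ₁ + ℓ₂ = n α`
(`0 < ℓ₁, ℓ₂`), a datum `ψ` whose bonds with both ends on an `α`-face of the box are `ε`-slow, a radius `0 < r`, `3r∕2 ≤ π`, a subsampling step `m` with the two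
packing numerics of ✓`exists_twoFaceCentre` (for every pair of sides), admit a section `W` equal to `ψ` on the two `α`-faces and with every bond of the box bounded
by any `B` dominating `max (π∕ℓ₁) (π∕ℓ₂)` and `((π−r)∕sin r)·ε`: centre from ✓`exists_twoFaceCentre`, two-leg filling from ✓`…SqrtGaugeStageIBlock`.
[cite: Balaban1985RegularSpaces, Thm 2 p.83] -/
theorem twoFace_section (hd : P.d = 3) (n s : Fin P.d → ℕ) (hN : ∀ κ, n κ + 1 < P.sitesPerDir j)
    (α : Fin P.d) (ℓ₁ ℓ₂ : ℕ) (hℓ₁ : 0 < ℓ₁) (hℓ₂ : 0 < ℓ₂) (hℓ : ℓ₁ + ℓ₂ = n α)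
    (ψ : Site P j → SU2) {ε r B : ℝ} (hε : 0 ≤ ε) (hr : 0 < r) (hrπ : 3 * r / 2 ≤ π)
    (m : ℕ) (hm : 1 ≤ m) (hrad : π / 2 * (((2 * (m - 1) : ℕ) : ℝ) * ε) ≤ r / 2)
    (hcard : ∀ nβ nγ : ℕ, (∃ κ, nβ = n κ) → (∃ κ, nγ = n κ) →
      ((2 * ((nβ / m + 1) * (nγ / m + 1)) : ℕ) : ℝ) * (2 / (3 * π) * (3 * r / 2) ^ 3) < 1)
    (hB1 : max (π / ℓ₁) (π / ℓ₂) ≤ B) (hB2 : ((π - r) / Real.sin r) * ε ≤ B)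
    (hletters : ∀ b : PBond P j, (∀ κ, (b.src κ - ((s κ : ℕ) : ZMod (P.sitesPerDir j))).val ≤ n κ) →
      (∀ κ, (b.tgt κ - ((s κ : ℕ) : ZMod (P.sitesPerDir j))).val ≤ n κ) →
      ((b.src α - ((s α : ℕ) : ZMod (P.sitesPerDir j))).val = 0 ∨ (b.src α - ((s α : ℕ) : ZMod (P.sitesPerDir j))).val = n α) →
      ((b.tgt α - ((s α : ℕ) : ZMod (P.sitesPerDir j))).val = 0 ∨ (b.tgt α - ((s α : ℕ) : ZMod (P.sitesPerDir j))).val = n α) →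
      dist1 (ψ b.src * (ψ b.tgt)⁻¹) ≤ ε) :
    ∃ W : Site P j → SU2,
      (∀ x : Site P j, (∀ κ, (x κ - ((s κ : ℕ) : ZMod (P.sitesPerDir j))).val ≤ n κ) →
        ((x α - ((s α : ℕ) : ZMod (P.sitesPerDir j))).val = 0 ∨ (x α - ((s α : ℕ) : ZMod (P.sitesPerDir j))).val = n α) → W x = ψ x) ∧
      (∀ b : PBond P j, (∀ κ, (b.src κ - ((s κ : ℕ) : ZMod (P.sitesPerDir j))).val ≤ n κ) →
        (∀ κ, (b.tgt κ - ((s κ : ℕ) : ZMod (P.sitesPerDir j))).val ≤ n κ) →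
        dist1 (W b.src * (W b.tgt)⁻¹) ≤ B) := by
  haveI : NeZero (P.sitesPerDir j) := ⟨P.sitesPerDir_ne_zero j⟩
  -- a second and a third axis
  haveI : Nontrivial (Fin P.d) := Fin.nontrivial_iff_two_le.mpr (by omega)
  obtain ⟨β, hβα⟩ := exists_ne α
  have hαβ : α ≠ β := Ne.symm hβα
  obtain ⟨γ, hγα, hγβ, hall⟩ := exists_third_axis hd α β hαβ
  have hrπ' : r < π := by linarith
  have hr0 : 0 ≤ r := hr.le
  -- the datum read on offset vectors
  set φ : (Fin P.d → ℕ) → SU2 := fun u => ψ (fun μ => ((s μ : ℕ) : ZMod (P.sitesPerDir j)) + ((u μ : ℕ) : ZMod (P.sitesPerDir j))) with hφ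
  set z : Fin P.d → ℕ := fun _ => 0 with hz
  -- a vector with small coordinates has small entries everywhere
  have hsmall : ∀ u : Fin P.d → ℕ, u α ≤ n α → u β ≤ n β → u γ ≤ n γ → ∀ κ, u κ < P.sitesPerDir j := by
    intro u h1 h2 h3 κ
    rcases hall κ with h | h | h
    · rw [h]; have := hN α; omega
    · rw [h]; have := hN β; omega
    · rw [h]; have := hN γ; omega
  have hinbox : ∀ u : Fin P.d → ℕ, u α ≤ n α → u β ≤ n β → u γ ≤ n γ → ∀ κ, u κ ≤ n κ := by
    intro u h1 h2 h3 κ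
    rcases hall κ with h | h | h <;> rw [h] <;> assumption
  -- the letter for a bond from the site of `u` in direction `κ`, both ends on an `α`-face
  have hbond : ∀ (u : Fin P.d → ℕ) (κ : Fin P.d), u α ≤ n α → u β ≤ n β → u γ ≤ n γ →
      Function.update u κ (u κ + 1) α ≤ n α → Function.update u κ (u κ + 1) β ≤ n β → Function.update u κ (u κ + 1) γ ≤ n γ →
      (u α = 0 ∨ u α = n α) → (Function.update u κ (u κ + 1) α = 0 ∨ Function.update u κ (u κ + 1) α = n α) →
      dist1 (φ u * (φ (Function.update u κ (u κ + 1)))⁻¹) ≤ ε := by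
    intro u κ h1 h2 h3 h1' h2' h3' hb hb'
    have hu := offset_siteOf (j := j) s u (hsmall u h1 h2 h3)
    have hu' := offset_siteOf (j := j) s (Function.update u κ (u κ + 1)) (hsmall _ h1' h2' h3')
    have h := hletters ⟨(fun μ => ((s μ : ℕ) : ZMod (P.sitesPerDir j)) + ((u μ : ℕ) : ZMod (P.sitesPerDir j))), κ⟩
    rw [tgt_siteOf] at h
    simp only [hu, hu'] at h
    exact h (hinbox u h1 h2 h3) (hinbox _ h1' h2' h3') hb hb'
  -- triple coordinates
  have hcα : ∀ i k l : ℕ, Function.update (Function.update (Function.update z α i) β k) γ l α = i := upd3_apply_fst hαβ hγα z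
  have hcβ : ∀ i k l : ℕ, Function.update (Function.update (Function.update z α i) β k) γ l β = k := upd3_apply_snd α hγβ z
  have hcγ : ∀ i k l : ℕ, Function.update (Function.update (Function.update z α i) β k) γ l γ = l := upd3_apply_thd α β γ z
  have hrebuild : ∀ w : Fin P.d → ℕ, w = Function.update (Function.update (Function.update z α (w α)) β (w β)) γ (w γ) :=
    fun w => eq_update3 hall hαβ hγα hγβ z w
  have hstepβ : ∀ i k l : ℕ, Function.update (Function.update (Function.update (Function.update z α i) β k) γ l) β (k + 1) =
      Function.update (Function.update (Function.update z α i) β (k + 1)) γ l := by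
    intro i k l
    rw [hrebuild (Function.update _ β (k + 1)), Function.update_self, Function.update_of_ne hαβ, Function.update_of_ne hγβ, hcα, hcγ]
  have hstepγ : ∀ i k l : ℕ, Function.update (Function.update (Function.update (Function.update z α i) β k) γ l) γ (l + 1) =
      Function.update (Function.update (Function.update z α i) β k) γ (l + 1) := by
    intro i k l
    rw [Function.update_idem]
  -- ONE centre for the two slow faces (packing)
  obtain ⟨a, ha⟩ := exists_twoFaceCentre (n α) (n β) (n γ) m hm
    (fun p : ℕ × ℕ × ℕ => φ (Function.update (Function.update (Function.update z α p.1) β p.2.1) γ p.2.2)) hε hr0 hrπ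
    (fun i k l hi hk hl => by
      have hi' : i ≤ n α := by rcases hi with h | h <;> omega
      have h := hbond (Function.update (Function.update (Function.update z α i) β k) γ l) β
      simp only [hcα, hcβ, hcγ, hstepβ] at h ⊢
      exact h hi' (by omega) hl hi' hk hl hi hi)
    (fun i k l hi hk hl => by
      have hi' : i ≤ n α := by rcases hi with h | h <;> omega
      have h := hbond (Function.update (Function.update (Function.update z α i) β k) γ l) γ
      simp only [hcα, hcβ, hcγ, hstepγ] at h ⊢
      exact h hi' hk (by omega) hi' hk hl hi hi)
    hrad (hcard (n β) (n γ) ⟨β, rfl⟩ ⟨γ, rfl⟩)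
  -- the cap letter on offset vectors
  have hcap : ∀ u : Fin P.d → ℕ, (u α = 0 ∨ u α = n α) → u β ≤ n β → u γ ≤ n γ → ‖logVec (su2Quat (a⁻¹ * φ u))‖ ≤ π - r := by
    intro u hu h2 h3
    have h := ha (u α) (u β) (u γ) hu h2 h3
    rw [← hrebuild u] at h
    exact h
  -- the GUARDED face data (corner data off the box, so that the cap letters hold for every offset vector)
  set φ₀ : (Fin P.d → ℕ) → SU2 := fun u =>
    if (∀ κ, u κ ≤ n κ) then φ (Function.update u α 0) else φ (Function.update z α 0) with hφ₀
  set φ₁ : (Fin P.d → ℕ) → SU2 := fun u =>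
    if (∀ κ, u κ ≤ n κ) then φ (Function.update u α (n α)) else φ (Function.update z α (n α)) with hφ₁
  have hφ₀in : ∀ u : Fin P.d → ℕ, (∀ κ, u κ ≤ n κ) → φ₀ u = φ (Function.update u α 0) := fun u hu => by
    simp only [hφ₀, if_pos hu]
  have hφ₁in : ∀ u : Fin P.d → ℕ, (∀ κ, u κ ≤ n κ) → φ₁ u = φ (Function.update u α (n α)) := fun u hu => by
    simp only [hφ₁, if_pos hu]
  have h₀ : ∀ u, ‖logVec (su2Quat (a⁻¹ * φ₀ u))‖ ≤ π - r := by
    intro u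
    by_cases hu : ∀ κ, u κ ≤ n κ
    · rw [hφ₀in u hu]
      refine hcap _ (Or.inl (Function.update_self ..)) ?_ ?_
      · rw [Function.update_of_ne hβα]; exact hu β
      · rw [Function.update_of_ne hγα]; exact hu γ
    · simp only [hφ₀, if_neg hu]
      refine hcap _ (Or.inl (Function.update_self ..)) ?_ ?_
      · rw [Function.update_of_ne hβα]; exact Nat.zero_le _
      · rw [Function.update_of_ne hγα]; exact Nat.zero_le _
  have h₁ : ∀ u, ‖logVec (su2Quat (a⁻¹ * φ₁ u))‖ ≤ π - r := by
    intro u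
    by_cases hu : ∀ κ, u κ ≤ n κ
    · rw [hφ₁in u hu]
      refine hcap _ (Or.inr (Function.update_self ..)) ?_ ?_
      · rw [Function.update_of_ne hβα]; exact hu β
      · rw [Function.update_of_ne hγα]; exact hu γ
    · simp only [hφ₁, if_neg hu]
      refine hcap _ (Or.inr (Function.update_self ..)) ?_ ?_
      · rw [Function.update_of_ne hβα]; exact Nat.zero_le _
      · rw [Function.update_of_ne hγα]; exact Nat.zero_le _
  -- the two-leg filling through the centre `a`, read on offset vectors
  set Wb : (Fin P.d → ℕ) → SU2 := fun t =>
    if t α ≤ ℓ₁ then φ₀ (Function.update t α 0) * expPoint ((((t α : ℕ) : ℝ) / ℓ₁) • logVec (su2Quat ((φ₀ (Function.update t α 0))⁻¹ * a)))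
    else a * expPoint ((((t α - ℓ₁ : ℕ) : ℝ) / ℓ₂) • logVec (su2Quat (a⁻¹ * φ₁ (Function.update t α 0)))) with hWb
  have hWb' : ∀ t, Wb t =
      if t α ≤ ℓ₁ then φ₀ (Function.update t α 0) * expPoint ((((t α : ℕ) : ℝ) / ℓ₁) • logVec (su2Quat ((φ₀ (Function.update t α 0))⁻¹ * a)))
      else a * expPoint ((((t α - ℓ₁ : ℕ) : ℝ) / ℓ₂) • logVec (su2Quat (a⁻¹ * φ₁ (Function.update t α 0)))) := fun t => rfl
  have hΛ0 : 0 ≤ (π - r) / Real.sin r := div_nonneg (by linarith) (Real.sin_nonneg_of_nonneg_of_le_pi hr0 hrπ'.le)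
  refine ⟨fun x => Wb (fun κ => (x κ - ((s κ : ℕ) : ZMod (P.sitesPerDir j))).val), fun x hx hface => ?_, fun b hsrc htgt => ?_⟩
  · -- (i) the two faces
    show Wb (fun κ => (x κ - ((s κ : ℕ) : ZMod (P.sitesPerDir j))).val) = ψ x
    rcases hface with h0 | h1
    · rw [stageI_face_zero φ₀ φ₁ a α ℓ₁ ℓ₂ Wb hWb' s x h0, hφ₀in _ hx,
        update_offsetZero_of_eq_zero _ α h0, hφ]
      simp only
      rw [siteOf_offset s x]
    · have h1' : (x α - ((s α : ℕ) : ZMod (P.sitesPerDir j))).val = ℓ₁ + ℓ₂ := by rw [hℓ]; exact h1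
      rw [stageI_face_end φ₀ φ₁ a α ℓ₁ ℓ₂ Wb hWb' s hℓ₂ x h1', hφ₁in _ ?_, Function.update_idem, ← h1, Function.update_eq_self, hφ]
      · simp only
        rw [siteOf_offset s x]
      · intro κ
        by_cases hκ : κ = α
        · subst hκ; rw [Function.update_self]; exact Nat.zero_le _
        · rw [Function.update_of_ne hκ]; exact hx κ
  · -- (ii) the bond laws by direction
    have hNb : (b.src b.dir - ((s b.dir : ℕ) : ZMod (P.sitesPerDir j))).val + 1 < P.sitesPerDir j := by
      have := hsrc b.dir; have := hN b.dir; omega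
    show dist1 (Wb (fun κ => (b.src κ - ((s κ : ℕ) : ZMod (P.sitesPerDir j))).val) *
      (Wb (fun κ => (b.tgt κ - ((s κ : ℕ) : ZMod (P.sitesPerDir j))).val))⁻¹) ≤ B
    by_cases hdir : b.dir = α
    · -- axial bond
      exact (dist1_stageI_axial_le φ₀ φ₁ a α ℓ₁ ℓ₂ Wb hWb' s hℓ₁ hℓ₂ b hdir hNb).trans hB1
    · -- transverse bond: the two face-adjacent bonds are face bonds of the box
      have htgtd : ∀ κ, (b.tgt κ - ((s κ : ℕ) : ZMod (P.sitesPerDir j))).val =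
          Function.update (fun κ => (b.src κ - ((s κ : ℕ) : ZMod (P.sitesPerDir j))).val) b.dir
            ((b.src b.dir - ((s b.dir : ℕ) : ZMod (P.sitesPerDir j))).val + 1) κ :=
        fun κ => congrArg (fun f => f κ) (offsets_tgt_eq_update s b hNb)
      set t : Fin P.d → ℕ := fun κ => (b.src κ - ((s κ : ℕ) : ZMod (P.sitesPerDir j))).val with ht
      have hk : (b.src α - ((s α : ℕ) : ZMod (P.sitesPerDir j))).val ≤ ℓ₁ + ℓ₂ := by rw [hℓ]; exact hsrc α
      have htr := dist1_stageI_transverse_le φ₀ φ₁ a α ℓ₁ ℓ₂ Wb hWb' s hr hrπ' h₀ h₁ hℓ₁ hℓ₂ b hdir hk hNb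
      refine htr.trans ((mul_le_mul_of_nonneg_left (max_le ?_ ?_) hΛ0).trans hB2)
      · -- face `0`: `z := t|_{α↦0}`, `z' := update z b.dir (t b.dir + 1)`
        have hzin : ∀ κ, Function.update t α 0 κ ≤ n κ := by
          intro κ
          by_cases hκ : κ = α
          · subst hκ; rw [Function.update_self]; exact Nat.zero_le _
          · rw [Function.update_of_ne hκ]; exact hsrc κ
        have hz'eq : Function.update (Function.update t α 0) b.dir ((b.src b.dir - ((s b.dir : ℕ) : ZMod (P.sitesPerDir j))).val + 1) =
            Function.update (Function.update t α 0) b.dir (Function.update t α 0 b.dir + 1) := by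
          rw [Function.update_of_ne hdir]
        have hz'in : ∀ κ, Function.update (Function.update t α 0) b.dir (Function.update t α 0 b.dir + 1) κ ≤ n κ := by
          intro κ
          by_cases hκ : κ = b.dir
          · subst hκ; rw [Function.update_self, Function.update_of_ne hdir]
            have h := htgt b.dir; rw [htgtd, Function.update_self] at h; exact h
          · rw [Function.update_of_ne hκ]; exact hzin κ
        have hz'α : Function.update (Function.update t α 0) b.dir (Function.update t α 0 b.dir + 1) α = 0 := by
          rw [Function.update_of_ne (Ne.symm hdir), Function.update_self]
        rw [hz'eq, hφ₀in _ hzin, hφ₀in _ hz'in, Function.update_idem,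
          update_offsetZero_of_eq_zero (Function.update (Function.update t α 0) b.dir (Function.update t α 0 b.dir + 1)) α hz'α]
        exact hbond (Function.update t α 0) b.dir (hzin α) (hzin β) (hzin γ) (hz'in α) (hz'in β) (hz'in γ)
          (Or.inl (Function.update_self ..)) (Or.inl hz'α)
      · -- face `n α`: `y := t|_{α↦n α}`, `y' := update y b.dir (t b.dir + 1)`
        have hzin : ∀ κ, Function.update t α 0 κ ≤ n κ := by
          intro κ
          by_cases hκ : κ = α
          · subst hκ; rw [Function.update_self]; exact Nat.zero_le _
          · rw [Function.update_of_ne hκ]; exact hsrc κ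
        have hyin : ∀ κ, Function.update t α (n α) κ ≤ n κ := by
          intro κ
          by_cases hκ : κ = α
          · subst hκ; rw [Function.update_self]
          · rw [Function.update_of_ne hκ]; exact hsrc κ
        have hz'eq : Function.update (Function.update t α 0) b.dir ((b.src b.dir - ((s b.dir : ℕ) : ZMod (P.sitesPerDir j))).val + 1) =
            Function.update (Function.update t α 0) b.dir (t b.dir + 1) := rfl
        have hz'in : ∀ κ, Function.update (Function.update t α 0) b.dir (t b.dir + 1) κ ≤ n κ := by
          intro κ
          by_cases hκ : κ = b.dir
          · subst hκ; rw [Function.update_self]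
            have h := htgt b.dir; rw [htgtd, Function.update_self] at h; exact h
          · rw [Function.update_of_ne hκ]; exact hzin κ
        have hy'eq : Function.update (Function.update (Function.update t α 0) b.dir (t b.dir + 1)) α (n α) =
            Function.update (Function.update t α (n α)) b.dir (Function.update t α (n α) b.dir + 1) := by
          rw [Function.update_comm hdir, Function.update_idem, Function.update_of_ne hdir]
        have hy'in : ∀ κ, Function.update (Function.update t α (n α)) b.dir (Function.update t α (n α) b.dir + 1) κ ≤ n κ := by
          intro κ
          by_cases hκ : κ = b.dir
          · subst hκ; rw [Function.update_self, Function.update_of_ne hdir]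
            have h := htgt b.dir; rw [htgtd, Function.update_self] at h; exact h
          · rw [Function.update_of_ne hκ]; exact hyin κ
        have hy'α : Function.update (Function.update t α (n α)) b.dir (Function.update t α (n α) b.dir + 1) α = n α := by
          rw [Function.update_of_ne (Ne.symm hdir), Function.update_self]
        rw [hz'eq, hφ₁in _ hzin, hφ₁in _ hz'in, Function.update_idem, hy'eq]
        exact hbond (Function.update t α (n α)) b.dir (hyin α) (hyin β) (hyin γ) (hy'in α) (hy'in β) (hy'in γ)
          (Or.inr (Function.update_self ..)) (Or.inr hy'α)

end Summit.QuantumFields.YangMills.Theorems.FluctuationComparisonRegPrIntLS2BetaSqrtGaugeFillingTwoFaceSection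

end
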